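import Summits.BirchSwinnertonDyer.Rank1Residual.Iwasawa.LambdaInvariantTwistedNonvanishing
import Literature.NumberTheory.EllipticCurves.PAdicGrossZagierConstantTermProofs
import HarnessLib

/-!
# Zero accounting with the order of vanishing at `T = 0`: `T^r ∣ G` and `G(ζ − 1) = 0` (`ζ` of order
# `pⁿ⁺¹`) ⇒ `r + φ(pⁿ⁺¹) ≤ λ(G)`; hence at a pair with `L(E,1) = 0` (or a split multiplicative `p`)
# the census bound `λ_an ≤ p − 1` already forbids every vanishing cyclotomic twist
# (cell `b2b-bsdres`; class-agnostic support for the (μ, λ) censuses; unit `b2b-bsdres-additive-p3`, gen 7)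

HONEST FRAMING (run/shared/lean/b2b/bsd-rank1-residual/, verbatim in every file): the goal of the
cell is to DELETE the COMBINATION-SHAPED residual classes of the Birch–Swinnerton-Dyer formula for
ALL analytic-rank `≤ 1` elliptic curves over `ℚ` — "full BSD formula for every rank `≤ 1` curve in
class `C`" assembled STRICTLY from published theorems — so that the rank-`≤ 1` remainder becomes
exactly the CONSTRUCTION-SHAPED classes, which are TYPED (missing-input `Prop`s), NOT attempted.
This is not "finishing BSD". THEOREMS ONLY; no named fact (Kato's Cor. 14.3 (2) appears only as the
displayed hypothesis `hK` of the tower statement); nothing about any curve is asserted; nothing booked;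
no label changes.

## What this file proves

The sibling files (p220367 `LambdaInvariantZeros`, p220573 `LambdaInvariantTwistedNonvanishing`)
show: a zero of `G ∈ Λ ∖ {0}` at `ζ − 1`, `ζ` of order `pⁿ⁺¹`, costs `φ(pⁿ⁺¹)` of `λ(G)`, so
`λ_an ≤ p − 2` forbids all vanishing cyclotomic twists. Here the zero at `T = 0` is accounted for as
well:

* §1 `add_totient_le_lam_of_X_pow_dvd`: `T^r ∣ G`, `G ≠ 0`, `∑ G_k(ζ − 1)^k = 0` ⇒
  `r + φ(pⁿ⁺¹) ≤ λ(G)` (`G = T^r · G₀`, `λ(G) = r + λ(G₀)`, `(ζ−1)^r ≠ 0`, and p220367 for `G₀`); so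
  `λ(G) < r + φ(pⁿ⁺¹)` ⇒ `G(ζ − 1) ≠ 0`, and `λ(G) < r + (p − 1)` ⇒ no zero at any `ζ − 1`,
  `ζ ∈ μ_{p^∞} ∖ {1}`.
* §2 with the twisted interpolation clause (`hI`, as in p220573) and an integral model `ι(G) = ϖ·L`
  with `T^r ∣ G`: `λ(G) < r + φ(pⁿ⁺¹)` ⇒ no vanishing Birch sum of conductor `p^{n+1+e₀}`;
  `λ(G) + 2 ≤ r + p` ⇒ none at any layer, `L(E, χ, 1) ≠ 0` for every `χ ≠ 1` of `Gal(ℚ_∞/ℚ)`, and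
  (granted `hK`, `p ≠ 2`) no rank growth in the tower.
* §3 where `r = 1` comes from: the CONSTANT-TERM clause of the interpolation property —
  good ordinary `p` with `L(E, 1) = 0` (`L_p(E, 0) = (1 − α⁻¹)² L(E,1)/Ω⁺ = 0`:
  `ordinary_X_dvd_of_entireLFunction_one_eq_zero`), split multiplicative `p`
  (`L(0) = (1 − 1)²·[0]⁺ = 0`, the trivial zero: `splitMult_X_dvd`), non-split multiplicative `p` with
  `L(E,1) = 0` (`L(0) = 2·[0]⁺`). Readings: `ordinary_forall_twistedLValue_ne_zero_of_analyticRank_ne_zero`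
  (`r_an ≠ 0`, `λ_an ≤ p − 1`), `splitMult_forall_twistedLValue_ne_zero_of_lam_lt` (`λ_an ≤ p − 1`),
  `mult_forall_twistedLValue_ne_zero_of_analyticRank_ne_zero`.

On iw-1's census (μ = 0, one row per (curve, p), 4 742 rows) the criterion of p220573 (`λ_an ≤ p − 2`)
covers 1 845 rows; with the order of vanishing accounted (`r = 1` at `r_an ≥ 1` or split `p`) the
count is 2 524 (X11b 499/769 instead of 190, X2 969/1559 instead of 599; `p = 3`: 1 603/3 707 instead
of 943): at a rank-one or split pair `λ_an = 2` at `p = 3` now suffices.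

References: [Washington1997] §7.1–7.2; [MazurTateTeitelbaum1986Invent] §I.12–I.15;
[GreenbergLNM1716] §4 (PDF p. 113); HOME/b2b-bsdres-additive-p3/X8-ROUTE-B.md §12 (gen 7).
-/

set_option autoImplicit false

noncomputable section

open scoped Classical MatrixGroups ModularForm

open CongruenceSubgroup Polynomial WeierstrassCurve Literature.NumberTheory.EllipticCurves
  Literature.NumberTheory.EllipticCurves.ModularForms
  Literature.NumberTheory.EllipticCurves.GreenbergVatsal2000
  Summit.BirchSwinnertonDyer.Rank1Residual.X1.MuLambda
  Summit.BirchSwinnertonDyer.Rank1Residual.X11a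
  Summit.BirchSwinnertonDyer.Rank1Residual.Supersingular

namespace Summit.BirchSwinnertonDyer.Rank1Residual.Iwasawa

variable {p : ℕ} [hp : Fact p.Prime]

/-! ## §1. `T^r ∣ G`, `G(ζ − 1) = 0` ⇒ `r + φ(pⁿ⁺¹) ≤ λ(G)` -/

section Zeros

/-- `λ(T^r) = r` in `Λ = ℤ_p⟦T⟧`. [cite: Washington1997, §7.1] -/
theorem lam_X_pow (r : ℕ) : lam ((PowerSeries.X : IwasawaAlgebra p) ^ r) = r := by
  have h := lam_X_pow_mul (p := p) (q := 1) ⟨0, by simp⟩ r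
  rw [mul_one] at h
  rw [h, ((isUnit_iff_mu_eq_zero_and_lam_eq_zero (1 : IwasawaAlgebra p)).mp isUnit_one).2.2,
    zero_add]

/-- `λ(T^r · G₀) = r + λ(G₀)` for `G₀ ≠ 0` (no unit-content hypothesis). [cite: Washington1997, §7.1] -/
theorem lam_X_pow_mul_eq_add {G₀ : IwasawaAlgebra p} (hG₀ : G₀ ≠ 0) (r : ℕ) :
    lam ((PowerSeries.X : IwasawaAlgebra p) ^ r * G₀) = r + lam G₀ := by
  rw [lam_mul (pow_ne_zero _ PowerSeries.X_ne_zero) hG₀, lam_X_pow]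

/-- **Zero accounting with the order at `T = 0`.** If `T^r ∣ G ≠ 0` in `Λ` and `G` vanishes at `ζ − 1`
for a primitive `pⁿ⁺¹`-th root of unity `ζ ∈ ℂ_p`, then `r + φ(pⁿ⁺¹) ≤ λ(G)`: `G = T^r G₀`,
`G(ζ−1) = (ζ−1)^r G₀(ζ−1)` with `ζ ≠ 1`, so `G₀(ζ−1) = 0` and `φ(pⁿ⁺¹) ≤ λ(G₀) = λ(G) − r`
(`totient_le_lam_of_hasSum_zero`, p220367). No hypothesis on `μ(G)`.
[cite: Washington1997, §7.1–7.2 and Thm. 7.3] -/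
theorem add_totient_le_lam_of_X_pow_dvd {G : IwasawaAlgebra p} (hG0 : G ≠ 0) {r : ℕ}
    (hX : (PowerSeries.X : IwasawaAlgebra p) ^ r ∣ G) {n : ℕ} {ζ : ℂ_[p]}
    (hζ : IsPrimitiveRoot ζ (p ^ (n + 1)))
    (hsum : HasSum (fun k ↦ ((algebraMap ℚ_[p] ℂ_[p]).comp (algebraMap ℤ_[p] ℚ_[p]))
      (PowerSeries.coeff k G) * (ζ - 1) ^ k) 0) :
    r + Nat.totient (p ^ (n + 1)) ≤ lam G := by
  set ιZ : ℤ_[p] →+* ℂ_[p] := (algebraMap ℚ_[p] ℂ_[p]).comp (algebraMap ℤ_[p] ℚ_[p]) with hιZ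
  have hbd : ∀ (A : PowerSeries ℤ_[p]) (k : ℕ), ‖ιZ (PowerSeries.coeff k A)‖ ≤ 1 :=
    norm_algebraMap_coeff_le_one
  obtain ⟨G₀, rfl⟩ := hX
  have hG₀ : G₀ ≠ 0 := fun h ↦ hG0 (by rw [h, mul_zero])
  have hz : ‖ζ - 1‖ < 1 := norm_sub_one_lt_one_of_pow_prime_pow_eq_one (j := n + 1) hζ.pow_eq_one
  -- `ζ ≠ 1`
  have hζ1 : ζ - 1 ≠ 0 := by
    rw [sub_ne_zero]
    intro h1
    have hone : (p ^ (n + 1) : ℕ) = 1 := hζ.eq_orderOf.trans (by rw [h1, orderOf_one])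
    have : 1 < p ^ (n + 1) := Nat.one_lt_pow (Nat.succ_ne_zero n) hp.out.one_lt
    omega
  -- `G(ζ-1) = (ζ-1)^r · G₀(ζ-1)`
  have heval : ∑' k, ιZ (PowerSeries.coeff k ((PowerSeries.X : IwasawaAlgebra p) ^ r * G₀)) *
      (ζ - 1) ^ k = (ζ - 1) ^ r * ∑' k, ιZ (PowerSeries.coeff k G₀) * (ζ - 1) ^ k := by
    rw [tsum_map_coeff_mul_mul_pow ιZ (hbd _) (hbd _) hz,
      show ((PowerSeries.X : IwasawaAlgebra p) ^ r) = ((X ^ r : ℤ_[p][X]) : PowerSeries ℤ_[p]) by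
        rw [Polynomial.coe_pow, Polynomial.coe_X],
      (hasSum_map_coeff_coe_mul_pow ιZ (X ^ r : ℤ_[p][X]) (ζ - 1)).tsum_eq, eval₂_pow, eval₂_X]
  rw [hsum.tsum_eq] at heval
  have h0 : ∑' k, ιZ (PowerSeries.coeff k G₀) * (ζ - 1) ^ k = 0 :=
    (mul_eq_zero.mp heval.symm).resolve_left (pow_ne_zero _ hζ1)
  have hsum₀ : HasSum (fun k ↦ ιZ (PowerSeries.coeff k G₀) * (ζ - 1) ^ k) 0 := by
    rw [← h0]
    exact (summable_map_coeff_mul_pow ιZ (hbd G₀) hz).hasSum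
  rw [lam_X_pow_mul_eq_add hG₀]
  exact Nat.add_le_add_left (totient_le_lam_of_hasSum_zero hG₀ hζ hsum₀) r

/-- Contrapositive: `T^r ∣ G ≠ 0`, `λ(G) < r + φ(pⁿ⁺¹)` ⇒ `G(ζ − 1) ≠ 0` for `ζ` of order `pⁿ⁺¹`.
[cite: Washington1997, §7.1–7.2 and Thm. 7.3] -/
theorem tsum_ne_zero_of_lam_lt_add_totient {G : IwasawaAlgebra p} (hG0 : G ≠ 0) {r : ℕ}
    (hX : (PowerSeries.X : IwasawaAlgebra p) ^ r ∣ G) {n : ℕ}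
    (hlam : lam G < r + Nat.totient (p ^ (n + 1))) {ζ : ℂ_[p]} (hζ : IsPrimitiveRoot ζ (p ^ (n + 1))) :
    ∑' k, ((algebraMap ℚ_[p] ℂ_[p]).comp (algebraMap ℤ_[p] ℚ_[p])) (PowerSeries.coeff k G) *
      (ζ - 1) ^ k ≠ 0 := by
  intro h0
  have hz : ‖ζ - 1‖ < 1 := norm_sub_one_lt_one_of_pow_prime_pow_eq_one (j := n + 1) hζ.pow_eq_one
  have hs := (summable_map_coeff_mul_pow ((algebraMap ℚ_[p] ℂ_[p]).comp (algebraMap ℤ_[p] ℚ_[p]))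
    (norm_algebraMap_coeff_le_one G) hz).hasSum
  rw [h0] at hs
  exact absurd hlam (not_lt.mpr (add_totient_le_lam_of_X_pow_dvd hG0 hX hζ hs))

end Zeros

/-! ## §2. With the interpolation clause: `λ(G) < r + φ(pⁿ⁺¹)` ⇒ no vanishing twist -/

section Twists

variable {N : ℕ} {f : CuspForm (Gamma0 N) 2}

/-- **`T^r ∣ G`, `λ(G) < r + φ(pⁿ⁺¹)` ⇒ every Birch sum of conductor `p^{n+1+e₀}` is non-zero**, for
`L` with the twisted interpolation clause for `(f, α)` and an integral model `ι(G) = ϖ·L`.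
[cite: MazurTateTeitelbaum1986Invent, §I.13–I.14] [cite: Washington1997, §7.1–7.2 and Thm. 7.3] -/
theorem ratTwistedSymbolSum_ne_zero_of_lam_lt_add {α : ℚ_[p]} {L : PowerSeries ℚ_[p]}
    (hI : ∀ (m : ℕ), 0 < m → ∀ χ : DirichletCharacter ℂ_[p] (p ^ m), χ.IsPrimitive → χ.Even →
      (∃ j : ℕ, orderOf χ = p ^ j) →
        HasSum (fun k : ℕ ↦ algebraMap ℚ_[p] ℂ_[p] (PowerSeries.coeff k L) *
            (χ (cyclotomicGenerator p : ZMod (p ^ m)) - 1) ^ k)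
          (algebraMap ℚ_[p] ℂ_[p] (α⁻¹ ^ m) * ratTwistedSymbolSum f χ))
    {G : IwasawaAlgebra p} {ϖ : ℚ_[p]} (hG : iwasawaToPowerSeries p G = PowerSeries.C ϖ * L)
    (hG0 : G ≠ 0) {r : ℕ} (hX : (PowerSeries.X : IwasawaAlgebra p) ^ r ∣ G) {n : ℕ}
    (hlam : lam G < r + Nat.totient (p ^ (n + 1)))
    (χ : DirichletCharacter ℂ_[p] (p ^ (n + 1 + cyclotomicExponent p))) (hχ : χ.IsPrimitive)
    (heven : χ.Even) (hord : ∃ j : ℕ, orderOf χ = p ^ j) : ratTwistedSymbolSum f χ ≠ 0 := by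
  intro h0
  have hm0 : 0 < n + 1 + cyclotomicExponent p := by omega
  have hme : cyclotomicExponent p < n + 1 + cyclotomicExponent p := by omega
  have hsum := hI (n + 1 + cyclotomicExponent p) hm0 χ hχ heven hord
  rw [h0, mul_zero] at hsum
  have horder : orderOf (χ (cyclotomicGenerator p : ZMod (p ^ (n + 1 + cyclotomicExponent p)))) =
      p ^ (n + 1) := by
    rw [orderOf_apply_cyclotomicGenerator hme χ hχ heven hord, Nat.add_sub_cancel]
  have hζ : IsPrimitiveRoot (χ (cyclotomicGenerator p : ZMod (p ^ (n + 1 + cyclotomicExponent p))))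
      (p ^ (n + 1)) := by
    rw [← horder]; exact IsPrimitiveRoot.orderOf _
  set ζ : ℂ_[p] := χ (cyclotomicGenerator p : ZMod (p ^ (n + 1 + cyclotomicExponent p))) with hζdef
  have hGsum : HasSum (fun k ↦ ((algebraMap ℚ_[p] ℂ_[p]).comp (algebraMap ℤ_[p] ℚ_[p]))
      (PowerSeries.coeff k G) * (ζ - 1) ^ k) 0 := by
    have h := hsum.mul_left (algebraMap ℚ_[p] ℂ_[p] ϖ)
    rw [mul_zero] at h
    refine h.congr_fun fun k ↦ ?_
    have hk : algebraMap ℤ_[p] ℚ_[p] (PowerSeries.coeff k G) = ϖ * PowerSeries.coeff k L := by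
      have h1 := congr_arg (PowerSeries.coeff k) hG
      rw [iwasawaToPowerSeries, PowerSeries.coeff_map, PowerSeries.coeff_C_mul] at h1
      exact h1
    show ((algebraMap ℚ_[p] ℂ_[p]).comp (algebraMap ℤ_[p] ℚ_[p])) (PowerSeries.coeff k G) * (ζ - 1) ^ k =
      algebraMap ℚ_[p] ℂ_[p] ϖ * (algebraMap ℚ_[p] ℂ_[p] (PowerSeries.coeff k L) * (ζ - 1) ^ k)
    rw [RingHom.comp_apply, hk, map_mul, mul_assoc]
  exact absurd hlam (not_lt.mpr (add_totient_le_lam_of_X_pow_dvd hG0 hX hζ hGsum))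

/-- **`T^r ∣ G`, `λ(G) + 2 ≤ r + p` ⇒ no vanishing Birch sum at ANY layer `n ≥ 1`.**
[cite: MazurTateTeitelbaum1986Invent, §I.13–I.14] [cite: Washington1997, §7.1–7.2 and Thm. 7.3] -/
theorem forall_ratTwistedSymbolSum_ne_zero_of_lam_add_two_le {α : ℚ_[p]} {L : PowerSeries ℚ_[p]}
    (hI : ∀ (m : ℕ), 0 < m → ∀ χ : DirichletCharacter ℂ_[p] (p ^ m), χ.IsPrimitive → χ.Even →
      (∃ j : ℕ, orderOf χ = p ^ j) →
        HasSum (fun k : ℕ ↦ algebraMap ℚ_[p] ℂ_[p] (PowerSeries.coeff k L) *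
            (χ (cyclotomicGenerator p : ZMod (p ^ m)) - 1) ^ k)
          (algebraMap ℚ_[p] ℂ_[p] (α⁻¹ ^ m) * ratTwistedSymbolSum f χ))
    {G : IwasawaAlgebra p} {ϖ : ℚ_[p]} (hG : iwasawaToPowerSeries p G = PowerSeries.C ϖ * L)
    (hG0 : G ≠ 0) {r : ℕ} (hX : (PowerSeries.X : IwasawaAlgebra p) ^ r ∣ G)
    (hsmall : lam G + 2 ≤ r + p) {n : ℕ} (hn : 0 < n)
    (χ : DirichletCharacter ℂ_[p] (p ^ (n + cyclotomicExponent p))) (hχ : χ.IsPrimitive)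
    (heven : χ.Even) (hord : ∃ j : ℕ, orderOf χ = p ^ j) : ratTwistedSymbolSum f χ ≠ 0 := by
  obtain ⟨n, rfl⟩ := Nat.exists_eq_succ_of_ne_zero hn.ne'
  refine ratTwistedSymbolSum_ne_zero_of_lam_lt_add hI hG hG0 hX
    (lt_of_lt_of_le (b := r + Nat.totient (p ^ 1)) ?_ ?_) χ hχ heven hord
  · rw [pow_one, Nat.totient_prime hp.out]
    have := hp.out.two_le
    omega
  · exact Nat.add_le_add_left (Nat.le_of_dvd (Nat.totient_pos.mpr (pow_pos hp.out.pos _))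
      (Nat.totient_dvd_of_dvd (pow_dvd_pow p (Nat.le_add_left 1 n)))) r

variable [NeZero N] {W : WeierstrassCurve ℚ} [W.IsElliptic]

omit [W.IsElliptic] in
/-- **Complex side: `T^r ∣ G`, `λ(G) + 2 ≤ r + p` ⇒ `L(E, χ, 1) ≠ 0`** for every primitive even
`p`-power-order `χ` of conductor `p^{n+e₀}`, `n ≥ 1`, and every entire continuation (`f` the newform of
`E = W`; Birch's formula proved in the tree; transport from gen 6).
[cite: MazurTateTeitelbaum1986Invent, §I.8 (8.6) and §I.13–I.14] -/
theorem forall_twistedLValue_ne_zero_of_lam_add_two_le (hf : IsNewformOf W f) {α : ℚ_[p]}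
    {L : PowerSeries ℚ_[p]}
    (hI : ∀ (m : ℕ), 0 < m → ∀ χ : DirichletCharacter ℂ_[p] (p ^ m), χ.IsPrimitive → χ.Even →
      (∃ j : ℕ, orderOf χ = p ^ j) →
        HasSum (fun k : ℕ ↦ algebraMap ℚ_[p] ℂ_[p] (PowerSeries.coeff k L) *
            (χ (cyclotomicGenerator p : ZMod (p ^ m)) - 1) ^ k)
          (algebraMap ℚ_[p] ℂ_[p] (α⁻¹ ^ m) * ratTwistedSymbolSum f χ))
    {G : IwasawaAlgebra p} {ϖ : ℚ_[p]} (hG : iwasawaToPowerSeries p G = PowerSeries.C ϖ * L)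
    (hG0 : G ≠ 0) {r : ℕ} (hX : (PowerSeries.X : IwasawaAlgebra p) ^ r ∣ G)
    (hsmall : lam G + 2 ≤ r + p) {n : ℕ} (hn : 0 < n)
    (χ : DirichletCharacter ℂ (p ^ (n + cyclotomicExponent p))) (hχ : χ.IsPrimitive) (hev : χ.Even)
    (hord : ∃ j : ℕ, orderOf χ = p ^ j) {Lχ : ℂ → ℂ} (hLd : Differentiable ℂ Lχ)
    (hLχ : ∀ s : ℂ, 2 < s.re → Lχ s = twistedLSeries f χ s) : Lχ 1 ≠ 0 := by
  haveI : NeZero (p ^ (n + cyclotomicExponent p)) := ⟨pow_ne_zero _ hp.out.ne_zero⟩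
  exact forall_twistedLValue_ne_zero_of_padic (f := f) hf
    (fun χ' hχ' hev' hord' ↦ forall_ratTwistedSymbolSum_ne_zero_of_lam_add_two_le hI hG hG0 hX hsmall
      hn χ' hχ' hev' hord') χ hχ hev hord hLd hLχ

set_option backward.isDefEq.respectTransparency false in
/-- **Tower: `T^r ∣ G`, `λ(G) + 2 ≤ r + p` ⇒ (granted Kato's Cor. 14.3 (2), `p ≠ 2`) no rank growth in
the cyclotomic `ℤ_p`-tower.** [cite: Kato2004Asterisque, Cor. 14.3 (2) (p. 235) and Thm. 14.4 (p. 236)] -/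
theorem exists_nsmul_mem_range_baseChange_layer_of_lam_add_two_le_of_kato
    (hK : kato_finite_chiPart_of_twistedLValue_ne_zero) (hp2 : p ≠ 2) (hf : IsNewformOf W f)
    {α : ℚ_[p]} {L : PowerSeries ℚ_[p]}
    (hI : ∀ (m : ℕ), 0 < m → ∀ χ : DirichletCharacter ℂ_[p] (p ^ m), χ.IsPrimitive → χ.Even →
      (∃ j : ℕ, orderOf χ = p ^ j) →
        HasSum (fun k : ℕ ↦ algebraMap ℚ_[p] ℂ_[p] (PowerSeries.coeff k L) *
            (χ (cyclotomicGenerator p : ZMod (p ^ m)) - 1) ^ k)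
          (algebraMap ℚ_[p] ℂ_[p] (α⁻¹ ^ m) * ratTwistedSymbolSum f χ))
    {G : IwasawaAlgebra p} {ϖ : ℚ_[p]} (hG : iwasawaToPowerSeries p G = PowerSeries.C ϖ * L)
    (hG0 : G ≠ 0) {r : ℕ} (hX : (PowerSeries.X : IwasawaAlgebra p) ^ r ∣ G)
    (hsmall : lam G + 2 ≤ r + p) {n : ℕ} [NeZero (p ^ (n + cyclotomicExponent p))]
    [DecidableEq (CyclotomicField (p ^ (n + cyclotomicExponent p)) ℚ)]
    {P : (W.baseChange (CyclotomicField (p ^ (n + cyclotomicExponent p)) ℚ)).toAffine.Point}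
    (hP : ∀ σ : CyclotomicField (p ^ (n + cyclotomicExponent p)) ℚ ≃ₐ[ℚ]
        CyclotomicField (p ^ (n + cyclotomicExponent p)) ℚ,
      (∃ w : rootsOfUnity (torsionOrder p) ℤ_[p],
        IsCyclotomicExtension.autEquivPow (CyclotomicField (p ^ (n + cyclotomicExponent p)) ℚ)
            (cyclotomic.irreducible_rat (NeZero.pos (p ^ (n + cyclotomicExponent p)))) σ =
          Units.map (PadicInt.toZModPow (n + cyclotomicExponent p)).toMonoidHom (w : ℤ_[p]ˣ)) →
      Affine.Point.map (W' := W.toAffine)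
        (σ : CyclotomicField (p ^ (n + cyclotomicExponent p)) ℚ →ₐ[ℚ]
          CyclotomicField (p ^ (n + cyclotomicExponent p)) ℚ) P = P) :
    ∃ m : ℕ, 0 < m ∧ m • P ∈ Set.range
      (Affine.Point.baseChange (W' := W.toAffine) ℚ
        (CyclotomicField (p ^ (n + cyclotomicExponent p)) ℚ)) :=
  exists_nsmul_mem_range_baseChange_layer_of_kato hK hp2 hf
    (fun _ hk _ χ hχ hev hord _ hLd hLχ ↦
      forall_twistedLValue_ne_zero_of_lam_add_two_le hf hI hG hG0 hX hsmall hk χ hχ hev hord hLd hLχ)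
    hP

end Twists

/-! ## §3. Where `T ∣ G` comes from: the constant-term clause of the interpolation property -/

section ConstantTerm

variable {N : ℕ} [NeZero N] {f : CuspForm (Gamma0 N) 2} {W : WeierstrassCurve ℚ} [W.IsElliptic]

omit [NeZero N] [W.IsElliptic] in
/-- `ι(G) = ϖ·L` with `L(0) = 0` ⇒ `T ∣ G`. [folklore] -/
theorem X_dvd_of_constantCoeff_eq_zero {L : PowerSeries ℚ_[p]} (hL0 : PowerSeries.constantCoeff L = 0)
    {G : IwasawaAlgebra p} {ϖ : ℚ_[p]} (hG : iwasawaToPowerSeries p G = PowerSeries.C ϖ * L) :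
    (PowerSeries.X : IwasawaAlgebra p) ^ 1 ∣ G := by
  rw [pow_one, PowerSeries.X_dvd_iff, ← PowerSeries.coeff_zero_eq_constantCoeff_apply]
  have h := congr_arg (PowerSeries.coeff 0) hG
  rw [PowerSeries.coeff_zero_eq_constantCoeff_apply (PowerSeries.C ϖ * L), map_mul,
    PowerSeries.constantCoeff_C, hL0, mul_zero, iwasawaToPowerSeries, PowerSeries.coeff_map] at h
  exact PadicInt.coe_eq_zero.mp h

variable [W.IsGloballyMinimal]

/-- **Good ordinary `p`, `L(E, 1) = 0` ⇒ `T ∣ G`** for every integral model `ι(G) = ϖ·L_p(E,T)`: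
`L_p(E, 0) = (1 − α⁻¹)² [0]⁺_f` (first clause of the interpolation THEOREM
`isPAdicLFunctionOf_padicLFunction_holds`) and `[0]⁺_f = L(E,1)/Ω⁺_f = 0`.
[cite: MazurSwinnertonDyer1974Invent, §9] [cite: MazurTateTeitelbaum1986Invent, §I.14 (14.3)] -/
theorem ordinary_X_dvd_of_entireLFunction_one_eq_zero (hord : IsOrdinaryAt W p) (hf : IsNewformOf W f)
    (hL1 : W.entireLFunction 1 = 0) {G : IwasawaAlgebra p} {ϖ : ℚ_[p]}
    (hG : iwasawaToPowerSeries p G = PowerSeries.C ϖ * padicLFunction f (unitRoot W p : ℚ_[p])) :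
    (PowerSeries.X : IwasawaAlgebra p) ^ 1 ∣ G :=
  X_dvd_of_constantCoeff_eq_zero (by
    rw [(isPAdicLFunctionOf_padicLFunction_holds hord hf).1,
      ratPlusSymbol_zero_eq_zero_of_entireLFunction_eq_zero hf hL1, Rat.cast_zero, mul_zero]) hG

/-- **Good ordinary `p`, `ord_{s=1} L(E,s) ≠ 0`, `λ_an ≤ p − 1` ⇒ `L(E, χ, 1) ≠ 0` for every
non-trivial character `χ` of `Gal(ℚ_∞/ℚ)`** (conductor `p^{n+e₀}`, `n ≥ 1`, any entire continuation).
At `p = 3` this reaches the rank-one census rows with `λ_an = 2` (where p220573 needed `λ_an ≤ 1`).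
[cite: MazurSwinnertonDyer1974Invent, §9] [cite: MazurTateTeitelbaum1986Invent, §I.14 (14.3)] -/
theorem ordinary_forall_twistedLValue_ne_zero_of_analyticRank_ne_zero (hord : IsOrdinaryAt W p)
    (hf : IsNewformOf W f) (hr : W.analyticRank ≠ 0) {G : IwasawaAlgebra p} {ϖ : ℚ_[p]}
    (hG : iwasawaToPowerSeries p G = PowerSeries.C ϖ * padicLFunction f (unitRoot W p : ℚ_[p]))
    (hG0 : G ≠ 0) (hsmall : lam G + 1 ≤ p) {n : ℕ} (hn : 0 < n)
    (χ : DirichletCharacter ℂ (p ^ (n + cyclotomicExponent p))) (hχ : χ.IsPrimitive) (hev : χ.Even)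
    (hordχ : ∃ j : ℕ, orderOf χ = p ^ j) {Lχ : ℂ → ℂ} (hLd : Differentiable ℂ Lχ)
    (hLχ : ∀ s : ℂ, 2 < s.re → Lχ s = twistedLSeries f χ s) : Lχ 1 ≠ 0 :=
  forall_twistedLValue_ne_zero_of_lam_add_two_le hf (isPAdicLFunctionOf_padicLFunction_holds hord hf).2
    hG hG0 (ordinary_X_dvd_of_entireLFunction_one_eq_zero hord hf
      (apply_eq_zero_of_analyticOrderNatAt_ne_zero (f := W.entireLFunction) hr) hG) (by omega) hn χ hχ
    hev hordχ hLd hLχ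

omit [NeZero N] [W.IsGloballyMinimal] [W.IsElliptic] in
/-- **Split multiplicative `p`: the trivial zero gives `T ∣ G`** for every integral model of THE
function of `IsSplitMultPAdicLFunctionOf f p L` (`L(0) = (1 − 1)²·[0]⁺_f = 0`).
[cite: MazurTateTeitelbaum1986Invent, §I.14 (14.3) and §I.15] -/
theorem splitMult_X_dvd {L : PowerSeries ℚ_[p]} (hL : IsSplitMultPAdicLFunctionOf f p L)
    {G : IwasawaAlgebra p} {ϖ : ℚ_[p]} (hG : iwasawaToPowerSeries p G = PowerSeries.C ϖ * L) :
    (PowerSeries.X : IwasawaAlgebra p) ^ 1 ∣ G :=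
  X_dvd_of_constantCoeff_eq_zero (by rw [hL.2.1, inv_one, sub_self, zero_pow two_ne_zero, zero_mul]) hG

omit [W.IsGloballyMinimal] [W.IsElliptic] in
/-- **Split multiplicative `p`, `λ_an ≤ p − 1` ⇒ `L(E, χ, 1) ≠ 0` for every non-trivial character of
`Gal(ℚ_∞/ℚ)`** (any analytic rank: the trivial zero pays for one unit of `λ`). At `p = 3`: `λ_an ≤ 2`,
which the rank-one split census rows (`λ_an = 2` by parity) meet. [cite: MazurTateTeitelbaum1986Invent, §I.14 (14.3) and §I.15] -/
theorem splitMult_forall_twistedLValue_ne_zero_of_lam_lt (hf : IsNewformOf W f) {L : PowerSeries ℚ_[p]}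
    (hL : IsSplitMultPAdicLFunctionOf f p L) {G : IwasawaAlgebra p} {ϖ : ℚ_[p]}
    (hG : iwasawaToPowerSeries p G = PowerSeries.C ϖ * L) (hG0 : G ≠ 0) (hsmall : lam G + 1 ≤ p)
    {n : ℕ} (hn : 0 < n) (χ : DirichletCharacter ℂ (p ^ (n + cyclotomicExponent p)))
    (hχ : χ.IsPrimitive) (hev : χ.Even) (hordχ : ∃ j : ℕ, orderOf χ = p ^ j) {Lχ : ℂ → ℂ}
    (hLd : Differentiable ℂ Lχ) (hLχ : ∀ s : ℂ, 2 < s.re → Lχ s = twistedLSeries f χ s) :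
    Lχ 1 ≠ 0 :=
  forall_twistedLValue_ne_zero_of_lam_add_two_le hf hL.2.2 hG hG0 (splitMult_X_dvd hL hG) (by omega)
    hn χ hχ hev hordχ hLd hLχ

omit [W.IsGloballyMinimal] [W.IsElliptic] in
/-- **Multiplicative `p` (package `IsMultPAdicLFunctionOf f p ε L`, e.g. non-split `ε = −1`),
`L(E, 1) = 0`, `λ_an ≤ p − 1` ⇒ `L(E, χ, 1) ≠ 0` for every non-trivial character of `Gal(ℚ_∞/ℚ)`**
(`L(0) = (1 − ε⁻¹)·[0]⁺_f = 0`). [cite: MazurTateTeitelbaum1986Invent, §I.14 (14.3) and §I.15]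
[cite: GreenbergLNM1716, §4 (PDF p. 113)] -/
theorem mult_forall_twistedLValue_ne_zero_of_entireLFunction_one_eq_zero (hf : IsNewformOf W f)
    (hL1 : W.entireLFunction 1 = 0) {ε : ℚ_[p]} {L : PowerSeries ℚ_[p]}
    (hL : IsMultPAdicLFunctionOf f p ε L) {G : IwasawaAlgebra p} {ϖ : ℚ_[p]}
    (hG : iwasawaToPowerSeries p G = PowerSeries.C ϖ * L) (hG0 : G ≠ 0) (hsmall : lam G + 1 ≤ p)
    {n : ℕ} (hn : 0 < n) (χ : DirichletCharacter ℂ (p ^ (n + cyclotomicExponent p)))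
    (hχ : χ.IsPrimitive) (hev : χ.Even) (hordχ : ∃ j : ℕ, orderOf χ = p ^ j) {Lχ : ℂ → ℂ}
    (hLd : Differentiable ℂ Lχ) (hLχ : ∀ s : ℂ, 2 < s.re → Lχ s = twistedLSeries f χ s) :
    Lχ 1 ≠ 0 :=
  forall_twistedLValue_ne_zero_of_lam_add_two_le hf hL.2.2 hG hG0
    (X_dvd_of_constantCoeff_eq_zero (by
      rw [hL.2.1, ratPlusSymbol_zero_eq_zero_of_entireLFunction_eq_zero hf hL1, Rat.cast_zero,
        mul_zero]) hG)
    (by omega) hn χ hχ hev hordχ hLd hLχ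

end ConstantTerm

end Summit.BirchSwinnertonDyer.Rank1Residual.Iwasawa

end
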